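import Summits.QuantumFields.BalabanUV.T4Continuum.Support.UrsellMayerSeries

/-!
# NE5 ∕ U3, route P2 — R-IDENT part (A1, second half): the ROOTED BLOCK DECOMPOSITION of the ordered series summed over tuples,
# the convolution identity `(n+1)·zc (n+1) = Σ_p (U (p+1)∕p!)·zc (n−p)`, and the partition function by levels

Cell `pub-balaban`, unit `b2b-balaban-t4-ne5-p2` (T⁴ fan-out NE5 ∕ node U3, PROVER seat P2 «polymer-activity Lipschitz ∕
Kotecký–Preiss route», lineage gen 18; journal CLAIM «R-IDENT»).  Summits-side new work under the LEAN PLACEMENT RULE (our generic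
bridge lemmas; NOT a Literature module, NOT a statement about any Bałaban paper).  HONEST FRAMING: rung (B)+1 of the FINITE-VOLUME
T⁴ continuum programme — NOT infinite volume, NOT a mass gap, NOT the Clay problem, NOT a proof of NE5.  HONEST DEPENDENCY (cell
line, verbatim): continuum YM on T⁴ ⇐ BetaPertH ∧ nine spine estimates (0/9 proved); BetaPertH ⇐ (D1) ∧ (D4) ∧ CAP+tail; G-an2-4
gates asym, D1 and NE2/3/4.

Continues `Support/UrsellMayerSeries` (same namespace; vocabulary `tgraph`∕`ursT`∕`freeT`∕`U`∕`E`∕`zc` there):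
* §4 **`sum_block_eq`** (at a fixed index block `S`, `Σ_Z ρᵀ(Z|S)·𝟙[Z|Sᶜ compatible]·Π w = U #S · E (#ι − #S)` — the tuple splits as
  `(Z|S, Z|Sᶜ)`), **`E_succ_eq_sum_choose`**: `E (n+1) = Σ_{p ≤ n} C(n,p)·U (p+1)·E (n−p)` (the tree's per-graph rooted identity
  `Literature.Probability.LatticeModels.sum_hcUrsell_mul_edgeFreeInd` — the block of the set partition containing the index `0` —
  summed over tuples), and the CONVOLUTION IDENTITY **`succ_mul_zc_succ`**: for a reflexive symmetric hard core
  `(n+1)·zc (n+1) = Σ_{p ≤ n} (U (p+1)∕p!)·zc (n−p)` — the coefficient form of `Z′ = F′·Z` consumed by (A2) `UrsellMayerLog`;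
* §5 `Z(univ; t•w) = Σ_{k ≤ #β} zc k·t^k` and `polymerRayDeriv = Σ_k k·zc k·t^{k−1}` (grouping the compatible families by cardinality).
Finite algebra over `ℂ`; no estimate, no Bałaban object.  0 sorry; axioms ⊆ {propext, Classical.choice, Quot.sound}.
-/

noncomputable section

open Finset
open scoped BigOperators

namespace Summit.QuantumFields.BalabanUV.T4Continuum.UrsellMayerSeries

open Literature.Probability.LatticeModels (IsCompatible hcUrsell edgeFreeInd sum_hcUrsell_mul_edgeFreeInd
  polymerPartitionFunction polymerRayDeriv polymerPartitionFunction_smul_eq)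

variable {β : Type*} (inc : β → β → Prop) [DecidableRel inc] {ι : Type*} [Fintype ι] [DecidableEq ι]

/-! ## §4 The rooted block decomposition summed over tuples, and the convolution identity -/

section Rooted

variable [Fintype β] [DecidableEq β] (w : β → ℂ)

omit [DecidableEq β] in
/-- [folklore] The level sums do not depend on the name of the index type: any finite index type of cardinality `n` gives `U n`. -/
theorem sum_ursT_prod_eq_U {κ : Type*} [Fintype κ] [DecidableEq κ] {n : ℕ} (e : κ ≃ Fin n) :
    ∑ Z : κ → β, (ursT inc Z : ℂ) * ∏ i, w (Z i) = U inc w n := by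
  unfold U
  refine Fintype.sum_equiv (e.arrowCongr (Equiv.refl β)) _ _ fun Z => ?_
  have hZ : (e.arrowCongr (Equiv.refl β)) Z = Z ∘ e.symm := by
    funext m; simp [Equiv.arrowCongr]
  rw [hZ, ursT_comp_equiv inc Z e.symm]
  congr 1
  exact Fintype.prod_equiv e _ _ fun i => by simp

omit [DecidableEq β] in
/-- [folklore] The same for the ordered partition function. -/
theorem sum_freeT_prod_eq_E {κ : Type*} [Fintype κ] [DecidableEq κ] {n : ℕ} (e : κ ≃ Fin n) :
    ∑ Z : κ → β, (freeT inc Z : ℂ) * ∏ i, w (Z i) = E inc w n := by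
  unfold E
  refine Fintype.sum_equiv (e.arrowCongr (Equiv.refl β)) _ _ fun Z => ?_
  have hZ : (e.arrowCongr (Equiv.refl β)) Z = Z ∘ e.symm := by
    funext m; simp [Equiv.arrowCongr]
  rw [hZ, freeT_comp_equiv inc Z e.symm]
  congr 1
  exact Fintype.prod_equiv e _ _ fun i => by simp

omit [DecidableEq β] in
/-- [folklore] THE BLOCK FACTORISATION at a fixed index block `S`: summing `ρᵀ(Z|S)·𝟙[Z|Sᶜ compatible]·Π w(Z m)` over all tuples
`Z : ι → β` gives `U #S · E (#ι − #S)` (the tuple splits as `(Z|S, Z|Sᶜ)`). -/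
theorem sum_block_eq (S : Finset ι) :
    ∑ Z : ι → β, (hcUrsell (tgraph inc Z) S : ℂ) * (edgeFreeInd (tgraph inc Z) (univ \ S) : ℂ) * ∏ m, w (Z m) =
      U inc w S.card * E inc w (Fintype.card ι - S.card) := by
  classical
  -- rewrite every summand through the two restrictions
  have hsummand : ∀ Z : ι → β,
      (hcUrsell (tgraph inc Z) S : ℂ) * (edgeFreeInd (tgraph inc Z) (univ \ S) : ℂ) * ∏ m, w (Z m) =
        ((ursT inc (fun i : S => Z i) : ℂ) * ∏ i : S, w (Z i)) *
          ((freeT inc (fun i : {m // m ∉ S} => Z i) : ℂ) * ∏ i : {m // m ∉ S}, w (Z i)) := by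
    intro Z
    rw [hcUrsell_tgraph_eq_ursT, edgeFreeInd_tgraph_sdiff_eq_freeT, ← Finset.prod_mul_prod_compl S (fun m => w (Z m)),
      ← Finset.prod_coe_sort S, Finset.prod_subtype (Sᶜ) (p := fun m => m ∉ S) (fun m => by simp)]
    ring
  rw [Finset.sum_congr rfl fun Z _ => hsummand Z]
  -- split the tuple along `S` / `Sᶜ`
  let e := Equiv.piEquivPiSubtypeProd (fun m : ι => m ∈ S) (fun _ => β)
  calc ∑ Z : ι → β, ((ursT inc (fun i : S => Z i) : ℂ) * ∏ i : S, w (Z i)) *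
          ((freeT inc (fun i : {m // m ∉ S} => Z i) : ℂ) * ∏ i : {m // m ∉ S}, w (Z i))
      = ∑ q : (S → β) × ({m // m ∉ S} → β),
          ((ursT inc q.1 : ℂ) * ∏ i : S, w (q.1 i)) * ((freeT inc q.2 : ℂ) * ∏ i : {m // m ∉ S}, w (q.2 i)) :=
        Fintype.sum_equiv e _ _ fun Z => rfl
    _ = (∑ Z₁ : S → β, (ursT inc Z₁ : ℂ) * ∏ i : S, w (Z₁ i)) *
          ∑ Z₂ : {m // m ∉ S} → β, (freeT inc Z₂ : ℂ) * ∏ i : {m // m ∉ S}, w (Z₂ i) := by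
        rw [Fintype.sum_prod_type, Finset.sum_mul_sum]
    _ = U inc w S.card * E inc w (Fintype.card ι - S.card) := by
        congr 1
        · exact sum_ursT_prod_eq_U inc w (Finset.equivFin S)
        · refine sum_freeT_prod_eq_E inc w (Fintype.equivFinOfCardEq ?_)
          rw [Fintype.card_subtype_compl, Fintype.card_coe]

omit [DecidableEq β] in
/-- [folklore] **THE ROOTED BLOCK DECOMPOSITION, SUMMED**: `E (n+1) = Σ_{p ≤ n} C(n,p)·U (p+1)·E (n−p)` (the block of the index `0`
has `p+1` elements, `C(n,p)` choices of the other `p`; the tree's `sum_hcUrsell_mul_edgeFreeInd` per tuple). -/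
theorem E_succ_eq_sum_choose (n : ℕ) :
    E inc w (n + 1) = ∑ p ∈ Finset.range (n + 1), (n.choose p : ℂ) * U inc w (p + 1) * E inc w (n - p) := by
  classical
  have h0 : (0 : Fin (n + 1)) ∈ (univ : Finset (Fin (n + 1))) := Finset.mem_univ _
  -- per tuple: the block containing `0`
  have hper : ∀ Z : Fin (n + 1) → β, (freeT inc Z : ℂ) * ∏ m, w (Z m) =
      ∑ P₀ ∈ (univ : Finset (Fin (n + 1))).powerset.filter (fun P => (0 : Fin (n + 1)) ∈ P),
        (hcUrsell (tgraph inc Z) P₀ : ℂ) * (edgeFreeInd (tgraph inc Z) (univ \ P₀) : ℂ) * ∏ m, w (Z m) := by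
    intro Z
    rw [← Finset.sum_mul]
    congr 1
    unfold freeT
    rw [← sum_hcUrsell_mul_edgeFreeInd (H := tgraph inc Z) h0]
    push_cast
    rfl
  rw [show E inc w (n + 1) = ∑ Z : Fin (n + 1) → β, (freeT inc Z : ℂ) * ∏ m, w (Z m) from rfl,
    Finset.sum_congr rfl fun Z _ => hper Z, Finset.sum_comm]
  rw [Finset.sum_congr rfl fun P₀ _ => sum_block_eq inc w P₀]
  -- reindex the blocks containing `0` by their other elements
  have hreindex : ∑ P₀ ∈ (univ : Finset (Fin (n + 1))).powerset.filter (fun P => (0 : Fin (n + 1)) ∈ P),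
      U inc w P₀.card * E inc w (Fintype.card (Fin (n + 1)) - P₀.card) =
        ∑ Q ∈ ((univ : Finset (Fin (n + 1))).erase 0).powerset, U inc w (Q.card + 1) * E inc w (n - Q.card) := by
    refine Finset.sum_nbij' (fun P₀ => P₀.erase 0) (fun Q => insert 0 Q) ?_ ?_ ?_ ?_ ?_
    · intro P₀ hP₀
      exact Finset.mem_powerset.2 (Finset.erase_subset_erase 0 (Finset.mem_powerset.1 (Finset.mem_filter.1 hP₀).1))
    · intro Q hQ
      refine Finset.mem_filter.2 ⟨Finset.mem_powerset.2 (Finset.subset_univ _), Finset.mem_insert_self 0 Q⟩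
    · intro P₀ hP₀
      exact Finset.insert_erase (Finset.mem_filter.1 hP₀).2
    · intro Q hQ
      have h0Q : (0 : Fin (n + 1)) ∉ Q := fun h => Finset.notMem_erase 0 univ (Finset.mem_powerset.1 hQ h)
      exact Finset.erase_insert h0Q
    · intro P₀ hP₀
      have h0P : (0 : Fin (n + 1)) ∈ P₀ := (Finset.mem_filter.1 hP₀).2
      have hcard : (P₀.erase 0).card + 1 = P₀.card := by
        rw [Finset.card_erase_of_mem h0P]
        exact Nat.sub_add_cancel (Finset.card_pos.2 ⟨0, h0P⟩)
      rw [hcard, Fintype.card_fin]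
      congr 2
      omega
  rw [hreindex, Finset.sum_powerset_apply_card (f := fun q => U inc w (q + 1) * E inc w (n - q)),
    Finset.card_erase_of_mem h0, Finset.card_univ, Fintype.card_fin, Nat.add_sub_cancel]
  refine Finset.sum_congr rfl fun p _ => ?_
  rw [nsmul_eq_mul]
  ring

/-- [folklore] **THE CONVOLUTION IDENTITY** (coefficient form of `Z′ = F′·Z` for the ordered series): for a reflexive symmetric hard
core, `(n+1)·zc (n+1) = Σ_{p ≤ n} (U (p+1)∕p!)·zc (n−p)`. -/
theorem succ_mul_zc_succ (hrefl : ∀ a, inc a a) (hsymm : ∀ a b, inc a b → inc b a) (n : ℕ) :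
    ((n : ℂ) + 1) * zc inc w (n + 1) =
      ∑ p ∈ Finset.range (n + 1), U inc w (p + 1) / (p.factorial : ℂ) * zc inc w (n - p) := by
  have hE := E_succ_eq_sum_choose inc w n
  rw [E_eq_factorial_mul_zc inc hrefl hsymm (n + 1) w] at hE
  have hn : (n.factorial : ℂ) ≠ 0 := by exact_mod_cast (Nat.factorial_pos n).ne'
  -- divide the rooted identity by `n!`
  have hE' : ((n : ℂ) + 1) * zc inc w (n + 1) =
      (∑ p ∈ Finset.range (n + 1), (n.choose p : ℂ) * U inc w (p + 1) * E inc w (n - p)) / (n.factorial : ℂ) := by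
    rw [← hE, Nat.factorial_succ]
    push_cast
    field_simp
  rw [hE', Finset.sum_div]
  refine Finset.sum_congr rfl fun p hp => ?_
  have hpn : p ≤ n := Nat.lt_succ_iff.1 (Finset.mem_range.1 hp)
  rw [E_eq_factorial_mul_zc inc hrefl hsymm (n - p) w]
  have hchoose : (n.choose p : ℂ) * (p.factorial : ℂ) * ((n - p).factorial : ℂ) = (n.factorial : ℂ) := by
    exact_mod_cast Nat.choose_mul_factorial_mul_factorial hpn
  have hp0 : (p.factorial : ℂ) ≠ 0 := by exact_mod_cast (Nat.factorial_pos p).ne'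
  have hnp0 : ((n - p).factorial : ℂ) ≠ 0 := by exact_mod_cast (Nat.factorial_pos (n - p)).ne'
  field_simp
  rw [← hchoose]
  ring

end Rooted

/-! ## §5 The partition function and its ray derivative by levels -/

section ByLevels

variable [Fintype β] [DecidableEq β] (w : β → ℂ)

/-- [folklore] `Z(univ; t•w) = Σ_{k ≤ #β} zc k · t^k`. -/
theorem polymerPartitionFunction_ray_eq_sum_zc (t : ℂ) :
    polymerPartitionFunction inc (fun γ => t * w γ) univ =
      ∑ k ∈ Finset.range (Fintype.card β + 1), zc inc w k * t ^ k := by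
  rw [polymerPartitionFunction_smul_eq]
  unfold zc
  rw [← Finset.sum_fiberwise_of_maps_to (g := fun X : Finset β => X.card) (t := Finset.range (Fintype.card β + 1))
    (fun X _ => Finset.mem_range.2 (Nat.lt_succ_of_le (Finset.card_le_univ X)))]
  refine Finset.sum_congr rfl fun k _ => ?_
  rw [Finset.sum_mul, Finset.filter_filter]
  refine Finset.sum_congr rfl fun X hX => ?_
  rw [(Finset.mem_filter.1 hX).2.2, mul_comm]

/-- [folklore] `(d∕dt) Z(univ; t•w) = Σ_{k ≤ #β} k · zc k · t^{k−1}`. -/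
theorem polymerRayDeriv_eq_sum_zc (t : ℝ) :
    polymerRayDeriv inc w univ t =
      ∑ k ∈ Finset.range (Fintype.card β + 1), (k : ℂ) * zc inc w k * (t : ℂ) ^ (k - 1) := by
  unfold polymerRayDeriv zc
  rw [← Finset.sum_fiberwise_of_maps_to (g := fun X : Finset β => X.card) (t := Finset.range (Fintype.card β + 1))
    (fun X _ => Finset.mem_range.2 (Nat.lt_succ_of_le (Finset.card_le_univ X)))]
  refine Finset.sum_congr rfl fun k _ => ?_
  rw [Finset.mul_sum, Finset.sum_mul, Finset.filter_filter]
  refine Finset.sum_congr rfl fun X hX => ?_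
  rw [(Finset.mem_filter.1 hX).2.2]
  ring

end ByLevels

end Summit.QuantumFields.BalabanUV.T4Continuum.UrsellMayerSeries

end
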